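import Summits.QuantumFields.BalabanUV.Beta.FP.TorusStepInsertionSymTwo
import Summits.QuantumFields.BalabanUV.Beta.FP.TorusStepInsertionSym
import Summits.QuantumFields.BalabanUV.Beta.FP.TorusCompositeObjectsG
import Summits.QuantumFields.BalabanUV.Beta.FP.PeriodisedSymBorderWardContactTwo
import Summits.QuantumFields.BalabanUV.Beta.FP.TorusCompositeCovarianceTwoStep

/-!
# `BalabanUV.Beta.FP.TorusCompositeCovarianceTwoStepSym` — road «FP» for binder row D1, ROUTE T, (β1) RE-BASING (ROW RULING R-D1-g52-1 (3)(c)), **(COV-m) ORDER 2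
# FOR THE (0.4)-SYMMETRISED TOWER, ONE STEP, AT THE RECORD's DIMENSION `d + 1 = 4` — THE SYM ONE-STEP SECOND-ORDER INSERTION JET's GAUGE-COVARIANCE LAW ON ALL
# COLUMNS**: `stepIns₂Sym w · D_fine = 2 • stepIns₁Sym w · Tip(w) − c_ℓ • QstepSym · Tip(w⊙w) + c_ℓ² • Far((QstepSym w)⊙(QstepSym w))` — the sym twin of leaf-02
# g25's I-3 `TorusCompositeCovarianceTwoStep.stepIns₂_mul_tgrad` (the brick of the sym composite tower's second chain rule, R-23 `compIns₂₂Sym`)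

WHY.  R-19 types the sym one-step second bi-jet `stepIns₂₂Sym` under reading (P) (the PLAIN symmetrised pair `½(symVh₂SAt ρ_c b b′_n + symVh₂SAt ρ_c b′_n b)` of an1's
(0.4)-symmetrised second-order border table, periodised in its second bond).  The ONE identity the composite order-2 chain rule consumes is its gauge-covariance law
on all columns.  Its contact supplier in the tree is leaf-02 g23's `PeriodisedSymBorderWardContactTwo.submatrix_borderT2per_mul_tgrad`, stated at `d + 1 = 4` (the
record's dimension) over an1's PACKAGED row table `symVh₂SAn1 3 Lc = atw (½ • (symVh₂SAt ρ_c + swap))`, whose `(inr, inl)` block is MINUS the plain pair's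
(`PeriodisedSymBorderT2IndexWard.symVh₂SAn1_inr_inl` vs R-19's `symVh₂SAt_inr_inl_eq` — the packed anti-twin; g30 W-5 l.56372 located the sign).  This file
bridges the sign on the `(inr, inl)` block through the periodisations (`perF ∕ perZ ∕ dper` act entrywise) and proves the law in I-3's shape, so that R-23's
`compIns₂₂Sym ∕ compIns₂Sym` inherit I-4's composite law verbatim (next file).  Generic-`d` would need the §2 torus letters of that supplier re-derived at
generic `d`; not done here (the record is `d + 1 = 4`; the order-2 ROWS are instance-only).

WHAT (`d := 3`; box `M : Fin (3+1) → ℕ`, blocking `Lc`, `[NeZero Lc]`; `hc : ctrOff (3+1) Lc ∈ box (3+1) Lc` displayed where the far root SITE is read).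
* §1 the sign bridge: `symPair_inr_inl_eq_neg_symVh₂SAn1` (entrywise), `submatrix_perF_dper_symPair_eq_neg` (through `dper_apply ∕ perZ_apply ∕ perF_apply`, `tsum_neg`).
* §2 **`pair_mul_tgrad_apply_sym (hc) (ℓ) (b b′ a s)`** — the per-pair entry of the sym bi-member against the fine gradient: `[s ≡ b′₊]·M^{b}_sym(a,b′) + [s ≡ b₊]·
  M^{b′}_sym(a,b) − [b = b′][s ≡ b₊]·c_ℓ·QstepSym(a,b) + [s = rootPt hc (a.1 + e_{a.2})]·(c_ℓ QstepSym(a,b))·(c_ℓ QstepSym(a,b′))` — I-3's `pair_mul_tgrad_apply` VERBATIM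
  under `vhSAt (toSite r) ↦ symVhSAt (ctr 4 Lc)`, `Qstep ↦ QstepSym`, `hr ↦ hc` (the supplier's overall minus cancelled by §1's).
* §3 **`stepIns₂Sym_mul_tgrad (hc) (ℓ) (w)`**: `stepIns₂Sym M Lc w * (tgrad (fine Lc M))↾(·, inl ·) id = 2 • (stepIns₁Sym M Lc w * Tip(w)) − c_ℓ • (QstepSym Lc M ℓ *
  Tip(w⊙w)) + c_ℓ² • Far((QstepSym Lc M ℓ *ᵥ w)⊙(QstepSym Lc M ℓ *ᵥ w))`, `Tip(v)(b, s) = v b · [s ≡ b.1 + e_{b.2}]`, `Far(v⊙v)(a, s) = (v a)² · [s = rootPt hc (a.1 + e_{a.2})]`,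
  `c_ℓ = (Lc⁴·stepScale 3 Lc ℓ)⁻¹` — I-3's finite algebra `step_entry_algebra` and R-18's `stepIns₁Sym_apply` BY NAME.
NOT HERE: the composite law (`compIns₂Sym_mul_tgrad`, the sym twin of I-4 — next), the rows `c2 ∕ d2`; generic `d`; any chart; any estimate.  [folklore] finite sums ∕
finitely supported `tsum` re-indexing BY NAME over OUR bookkeeping objects and an1's typed tables; no `def`, no `def … : Prop`, nothing cited, 0 sorry, default heartbeats.
Nothing of the dictionary ∕ Bałaban's non-linear averages asserted (that the (β1) one-step second variation IS this brick is the ROW's ruling ∕ an2's (C1) TABLE word,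
quoted); NO chart fixed; the (C1) TABLES, the seven letters, `hH ∕ hQ` untouched.

HONEST DEPENDENCY (page 1, mandatory): continuum YM on T⁴ ⇐ BetaPertH ∧ nine spine estimates (0/9 proved); BetaPertH ⇐ (D1) ∧ (D4) ∧ CAP+tail;
G-an2-4 gates asym, D1 and NE2/3/4.  HONEST FRAMING (cell contract, verbatim): «discharging `BetaPertH` makes Bałaban's UV stability UNCONDITIONAL —
a real constructive-QFT result; it is NOT the continuum limit and NOT the Clay problem.»  ABSOLUTE RULE (cell charter, verbatim): «No internally-minted
statement may enter as a cited fact. Every hypothesis is either kernel-proved in this package or a verbatim quotation of a PUBLISHED theorem with page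
reference. The manuscript(s) under audit are NOT citable for their own disputed steps — they are the thing under adjudication; programme-internal
(2001/route/tribunal) claims are never citable.»  0 estimates; 0∕4 row-D1 binders (hW, hR, D1Tel, D1Rep); NOT (T-ID), NOT (C1), NOT SDF, NOT D1,
NOT BetaPertH, NOT continuum, NOT Clay.  D1 formalisation swarm LEAF PROVER 02 (b2b-balaban-beta-d1-formalise-leaf-02 gen 32), 2026-08-24.  No existing file touched.
-/

noncomputable section

open scoped BigOperators

namespace Summit.QuantumFields.BalabanUV.Beta.FP.TorusCompositeCovarianceTwoStepSym

open Matrix Finset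
open Literature.MathematicalPhysics.QuantumFieldTheory
open Literature.MathematicalPhysics.QuantumFieldTheory.Balaban1983to89
open Literature.MathematicalPhysics.QuantumFieldTheory.Balaban1983to89.Beta
open ExpKernelCalculus (MKer)
open B5Prop11Plancherel (fine)
open B6Lemma24Torus (pbox mem_pbox)
open AffineAveraging (Site box toSite unitVec)
open AveragingContours (off blk)
open AveragingContoursRooted (ctr ctrOff ctrOff_mem_box)
open OneStepResolventKernel (Fib)
open B4TorusKernel.MultiPeriod (translate)
open Summit.QuantumFields.BalabanUV.Beta.BorderedHessian (stepScale stepScale_ne_zero)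
open Summit.QuantumFields.BalabanUV.Beta.DshAn1 (Dsh)
open Summit.QuantumFields.BalabanUV.Beta.SymShiftedSpread (bhKStepSh)
open Summit.QuantumFields.BalabanUV.Beta.SymAveragingHessianCounts (symVhSAt)
open Summit.QuantumFields.BalabanUV.Beta.SymAveragingMixedJetTables (symVh2KerAt symVh₂SAt)
open Summit.QuantumFields.BalabanUV.Beta.SymSecondOrderTablesAn1 (symVh₂SAn1)
open Summit.QuantumFields.BalabanUV.Beta.FP.KernelPeriodisationFib (Idx perF perF_apply perZ perZ_apply)
open Summit.QuantumFields.BalabanUV.Beta.FP.KernelPeriodisationFibLoc (dper dper_apply)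
open Summit.QuantumFields.BalabanUV.Beta.FP.TorusGaugeCovariance (tdelta tgrad)
open Summit.QuantumFields.BalabanUV.Beta.FP.TorusGaugeCovariancePairing (wrapPt wrapPt_of_mem)
open Summit.QuantumFields.BalabanUV.Beta.FP.TorusGaugeCovarianceCoarse (coarsePt)
open Summit.QuantumFields.BalabanUV.Beta.FP.PeriodisedSymBorderT2IndexWard (symVh₂SAn1_inr_inl)
open Summit.QuantumFields.BalabanUV.Beta.FP.PeriodisedSymBorderWardContactTwo (submatrix_borderT2per_mul_tgrad)
open Summit.QuantumFields.BalabanUV.Beta.FP.TorusCompositeObjects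
open Summit.QuantumFields.BalabanUV.Beta.FP.TorusCompositeObjectsG (QstepSym)
open Summit.QuantumFields.BalabanUV.Beta.FP.TorusCompositeCovariance (rootPt wrapPt_coarsePt_add_add)
open Summit.QuantumFields.BalabanUV.Beta.FP.TorusCompositeCovarianceOne (tdelta_wrapPt)
open Summit.QuantumFields.BalabanUV.Beta.FP.TorusCompositeCovarianceTwoStep (ite_bond_eq step_entry_algebra)
open Summit.QuantumFields.BalabanUV.Beta.FP.TorusStepInsertionSym (stepIns₁Sym stepIns₁Sym_apply)
open Summit.QuantumFields.BalabanUV.Beta.FP.TorusStepInsertionSymTwo (stepIns₂₂Sym stepIns₂Sym symVh₂SAt_inr_inl_eq)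

section OneStep

variable (M : Fin (3 + 1) → ℕ) [∀ μ, NeZero (M μ)] (Lc : ℕ) [NeZero Lc]

/-! ## §1 The sign bridge on the `(inr, inl)` block: the plain sym pair is MINUS an1's packed row table -/

omit [∀ μ, NeZero (M μ)] [NeZero Lc] in
/-- [folklore] entrywise on the `(inr μ, inl α)` block: `½(S κ u κ′ w + S κ′ w κ u) x z = − symVh₂SAn1 3 Lc κ u κ′ w x z` (`S := symVh₂SAt (ctr 4 Lc) Lc`; R-19's
`symVh₂SAt_inr_inl_eq` against my g23 `symVh₂SAn1_inr_inl` — the packed anti-twin `atw` flips the sign of this block). -/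
theorem symPair_inr_inl_eq_neg_symVh₂SAn1 (κ : Fin (3 + 1)) (u : Site (3 + 1)) (κ' : Fin (3 + 1)) (w x z : Site (3 + 1)) (μ α : Fin (3 + 1)) :
    (1 / 2 : ℝ) * (symVh₂SAt (ctr (3 + 1) Lc) Lc κ u κ' w x z (Sum.inr μ) (Sum.inl α) + symVh₂SAt (ctr (3 + 1) Lc) Lc κ' w κ u x z (Sum.inr μ) (Sum.inl α))
      = -symVh₂SAn1 3 Lc κ u κ' w x z (Sum.inr μ) (Sum.inl α) := by
  rw [symVh₂SAn1_inr_inl, symVh₂SAt_inr_inl_eq, symVh₂SAt_inr_inl_eq, neg_neg]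
  split_ifs
  · rfl
  · ring

omit [∀ μ, NeZero (M μ)] [NeZero Lc] in
/-- [folklore] **THE SIGN BRIDGE THROUGH THE PERIODISATIONS** (ANY torus `T`): on the `(inr, inl)` block, the torus member of R-19's second-bond-periodised plain sym pair
at `(b, b′)` is MINUS the torus member of the second-bond-periodised an1 row table (`perF ∕ perZ ∕ dper` act entrywise; `tsum_neg`). -/
theorem perF_dper_symPair_eq_neg (T : Fin (3 + 1) → ℕ) [∀ μ, NeZero (T μ)] (b b' : ↥(pbox T) × Fin (3 + 1)) (p q : ↥(pbox T)) (μ α : Fin (3 + 1)) :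
    perF T (dper T (fun x z a c => ∑' n : Site (3 + 1), (1 / 2 : ℝ) *
        (symVh₂SAt (ctr (3 + 1) Lc) Lc b.2 (b.1 : Site (3 + 1)) b'.2 (translate T (b'.1 : Site (3 + 1)) n) x z a c
          + symVh₂SAt (ctr (3 + 1) Lc) Lc b'.2 (translate T (b'.1 : Site (3 + 1)) n) b.2 (b.1 : Site (3 + 1)) x z a c))) (p, Sum.inr μ) (q, Sum.inl α)
      = -perF T (dper T ((fun κ u x z a c => ∑' n : Site (3 + 1), symVh₂SAn1 3 Lc κ u b'.2 (translate T (b'.1 : Site (3 + 1)) n) x z a c)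
          b.2 (b.1 : Site (3 + 1)))) (p, Sum.inr μ) (q, Sum.inl α) := by
  simp only [perF_apply, perZ_apply, dper_apply]
  rw [← tsum_neg]
  refine tsum_congr fun m => ?_
  rw [← tsum_neg]
  refine tsum_congr fun m' => ?_
  rw [← tsum_neg]
  exact tsum_congr fun n => symPair_inr_inl_eq_neg_symVh₂SAn1 Lc _ _ _ _ _ _ _ _

/-! ## §2 The per-pair entry of the sym bi-member against the fine gradient -/

/-- [folklore] **THE PER-PAIR ENTRY OF THE SYM BI-MEMBER AGAINST THE FINE GRADIENT** (my g23 `submatrix_borderT2per_mul_tgrad` at R-19's slot maps, the overall sign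
cancelled by §1, the far root named by `rootPt hc`): `(T^{b,b′}_sym·D)(a, s) = [s ≡ b′₊]·M^{b}_sym(a,b′) + [s ≡ b₊]·M^{b′}_sym(a,b) − [b = b′][s ≡ b₊]·c_ℓ·QstepSym(a,b)
+ [s = rootPt hc (a.1 + e_{a.2})]·(c_ℓ QstepSym(a,b))·(c_ℓ QstepSym(a,b′))` — I-3's `pair_mul_tgrad_apply` under the (β1) substitution. -/
theorem pair_mul_tgrad_apply_sym (hc : ctrOff (3 + 1) Lc ∈ box (3 + 1) Lc) (ℓ : ℕ) (b b' : ↥(pbox (fine Lc M)) × Fin (3 + 1)) (a : ↥(pbox M) × Fin (3 + 1))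
    (s : ↥(pbox (fine Lc M))) :
    ((perF (fine Lc M) (dper (fine Lc M) (fun x z a c => ∑' n : Site (3 + 1), (1 / 2 : ℝ) *
        (symVh₂SAt (ctr (3 + 1) Lc) Lc b.2 (b.1 : Site (3 + 1)) b'.2 (translate (fine Lc M) (b'.1 : Site (3 + 1)) n) x z a c
          + symVh₂SAt (ctr (3 + 1) Lc) Lc b'.2 (translate (fine Lc M) (b'.1 : Site (3 + 1)) n) b.2 (b.1 : Site (3 + 1)) x z a c)))).submatrix
          (fun a : ↥(pbox M) × Fin (3 + 1) => ((coarsePt M Lc a.1, Sum.inr a.2) : Idx (fine Lc M) (Fib 3)))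
          (fun c : ↥(pbox (fine Lc M)) × Fin (3 + 1) => ((c.1, Sum.inl c.2) : Idx (fine Lc M) (Fib 3)))
        * (tgrad (fine Lc M)).submatrix (fun b : ↥(pbox (fine Lc M)) × Fin (3 + 1) => ((b.1, Sum.inl b.2) : Idx (fine Lc M) (Fib 3))) id) a s
      = tdelta (fine Lc M) ((b'.1 : Site (3 + 1)) + unitVec b'.2) s
            * perF (fine Lc M) (dper (fine Lc M) (symVhSAt (ctr (3 + 1) Lc) 3 Lc rfl b.2 (b.1 : Site (3 + 1)))) (coarsePt M Lc a.1, Sum.inr a.2) (b'.1, Sum.inl b'.2)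
        + tdelta (fine Lc M) ((b.1 : Site (3 + 1)) + unitVec b.2) s
            * perF (fine Lc M) (dper (fine Lc M) (symVhSAt (ctr (3 + 1) Lc) 3 Lc rfl b'.2 (b'.1 : Site (3 + 1)))) (coarsePt M Lc a.1, Sum.inr a.2) (b.1, Sum.inl b.2)
        - tdelta (fine Lc M) ((b.1 : Site (3 + 1)) + unitVec b.2) s * ((if b = b' then (1 : ℝ) else 0) * ((((Lc : ℝ) ^ (3 + 1) * stepScale 3 Lc ℓ)⁻¹) * QstepSym Lc M ℓ a b))
        + tdelta (fine Lc M) ((rootPt M Lc hc (wrapPt M ((a.1 : Site (3 + 1)) + unitVec a.2)) : ↥(pbox (fine Lc M))) : Site (3 + 1)) s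
            * (((((Lc : ℝ) ^ (3 + 1) * stepScale 3 Lc ℓ)⁻¹) * QstepSym Lc M ℓ a b) * ((((Lc : ℝ) ^ (3 + 1) * stepScale 3 Lc ℓ)⁻¹) * QstepSym Lc M ℓ a b')) := by
  -- the left-hand side through the sign bridge, entry by entry, then my g23 supplier at R-19's slot maps
  have hL : ((perF (fine Lc M) (dper (fine Lc M) (fun x z a c => ∑' n : Site (3 + 1), (1 / 2 : ℝ) *
        (symVh₂SAt (ctr (3 + 1) Lc) Lc b.2 (b.1 : Site (3 + 1)) b'.2 (translate (fine Lc M) (b'.1 : Site (3 + 1)) n) x z a c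
          + symVh₂SAt (ctr (3 + 1) Lc) Lc b'.2 (translate (fine Lc M) (b'.1 : Site (3 + 1)) n) b.2 (b.1 : Site (3 + 1)) x z a c)))).submatrix
          (fun a : ↥(pbox M) × Fin (3 + 1) => ((coarsePt M Lc a.1, Sum.inr a.2) : Idx (fine Lc M) (Fib 3)))
          (fun c : ↥(pbox (fine Lc M)) × Fin (3 + 1) => ((c.1, Sum.inl c.2) : Idx (fine Lc M) (Fib 3)))
        * (tgrad (fine Lc M)).submatrix (fun b : ↥(pbox (fine Lc M)) × Fin (3 + 1) => ((b.1, Sum.inl b.2) : Idx (fine Lc M) (Fib 3))) id) a s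
      = -(((perF (fine Lc M) (dper (fine Lc M) ((fun κ u x z a c => ∑' n : Site (3 + 1), symVh₂SAn1 3 Lc κ u b'.2 (translate (fine Lc M) (b'.1 : Site (3 + 1)) n) x z a c)
          b.2 (b.1 : Site (3 + 1))))).submatrix
          (fun a : ↥(pbox M) × Fin (3 + 1) => (((⟨(coarsePt M Lc a.1 : Site (3 + 1)), (coarsePt M Lc a.1).2⟩ : ↥(pbox (fine Lc M))), Sum.inr a.2) : Idx (fine Lc M) (Fib 3)))
          (fun c : ↥(pbox (fine Lc M)) × Fin (3 + 1) => ((c.1, Sum.inl c.2) : Idx (fine Lc M) (Fib 3)))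
        * (tgrad (fine Lc M)).submatrix (fun b : ↥(pbox (fine Lc M)) × Fin (3 + 1) => ((b.1, Sum.inl b.2) : Idx (fine Lc M) (Fib 3))) id) a s) := by
    rw [Matrix.mul_apply, Matrix.mul_apply, ← Finset.sum_neg_distrib]
    refine Finset.sum_congr rfl fun q _ => ?_
    rw [← neg_mul]
    exact congrArg (fun t : ℝ => t * (tgrad (fine Lc M)).submatrix (fun b : ↥(pbox (fine Lc M)) × Fin (3 + 1) => ((b.1, Sum.inl b.2) : Idx (fine Lc M) (Fib 3))) id q s)
      (perF_dper_symPair_eq_neg Lc (fine Lc M) b b' (coarsePt M Lc a.1) q.1 a.2 q.2)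
  rw [hL, submatrix_borderT2per_mul_tgrad (M := fine Lc M) (M' := M) b'.2 (b'.1 : Site (3 + 1)) (fun i => rfl) rfl b'.1.2 ℓ
      (fun a : ↥(pbox M) × Fin (3 + 1) => (coarsePt M Lc a.1 : Site (3 + 1))) (fun a => (coarsePt M Lc a.1).2) (fun a : ↥(pbox M) × Fin (3 + 1) => a.2) id
      b.2 b.1 a s,
    neg_neg, ite_bond_eq, show ctr (3 + 1) Lc = toSite (ctrOff (3 + 1) Lc) from rfl,
    ← tdelta_wrapPt (fine Lc M) ((coarsePt M Lc a.1 : Site (3 + 1)) + toSite (ctrOff (3 + 1) Lc) + (Lc : ℤ) • unitVec a.2), wrapPt_coarsePt_add_add M Lc hc]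
  rfl

/-! ## §3 The sym one-step second-order law on all columns -/

/-- [folklore] **`stepIns₂Sym_mul_tgrad` — THE (0.4)-SYMMETRISED ONE-STEP SECOND-ORDER COVARIANCE LAW ON ALL GAUGE COLUMNS** (`d + 1 = 4`; centred root `hc`; ANY level
`ℓ` on the right): `stepIns₂Sym w · D_fine = 2 • (stepIns₁Sym w · Tip(w)) − c_ℓ • (QstepSym_ℓ · Tip(w⊙w)) + c_ℓ² • Far((QstepSym_ℓ w)⊙(QstepSym_ℓ w))` — I-3's
`stepIns₂_mul_tgrad` VERBATIM under the (β1) substitution (its finite algebra `step_entry_algebra` and R-18's `stepIns₁Sym_apply` BY NAME). -/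
theorem stepIns₂Sym_mul_tgrad (hc : ctrOff (3 + 1) Lc ∈ box (3 + 1) Lc) (ℓ : ℕ) (w : ↥(pbox (fine Lc M)) × Fin (3 + 1) → ℝ) :
    stepIns₂Sym M Lc w * (tgrad (fine Lc M)).submatrix (fun b : ↥(pbox (fine Lc M)) × Fin (3 + 1) => ((b.1, Sum.inl b.2) : Idx (fine Lc M) (Fib 3))) id
      = (2 : ℝ) • (stepIns₁Sym M Lc w * Matrix.of (fun (b : ↥(pbox (fine Lc M)) × Fin (3 + 1)) (s : ↥(pbox (fine Lc M))) =>
              w b * tdelta (fine Lc M) ((b.1 : Site (3 + 1)) + unitVec b.2) s))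
        - (((Lc : ℝ) ^ (3 + 1) * stepScale 3 Lc ℓ)⁻¹) • (QstepSym Lc M ℓ * Matrix.of (fun (b : ↥(pbox (fine Lc M)) × Fin (3 + 1)) (s : ↥(pbox (fine Lc M))) =>
              (w b * w b) * tdelta (fine Lc M) ((b.1 : Site (3 + 1)) + unitVec b.2) s))
        + (((Lc : ℝ) ^ (3 + 1) * stepScale 3 Lc ℓ)⁻¹) ^ 2 • Matrix.of (fun (a : ↥(pbox M) × Fin (3 + 1)) (s : ↥(pbox (fine Lc M))) =>
              ((QstepSym Lc M ℓ *ᵥ w) a) ^ 2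
                * tdelta (fine Lc M) ((rootPt M Lc hc (wrapPt M ((a.1 : Site (3 + 1)) + unitVec a.2)) : ↥(pbox (fine Lc M))) : Site (3 + 1)) s) := by
  ext a s
  -- the left-hand side, pair by pair
  have hL : (stepIns₂Sym M Lc w * (tgrad (fine Lc M)).submatrix (fun b : ↥(pbox (fine Lc M)) × Fin (3 + 1) => ((b.1, Sum.inl b.2) : Idx (fine Lc M) (Fib 3))) id) a s
      = ∑ b : ↥(pbox (fine Lc M)) × Fin (3 + 1), ∑ b' : ↥(pbox (fine Lc M)) × Fin (3 + 1), w b * w b'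
          * (tdelta (fine Lc M) ((b'.1 : Site (3 + 1)) + unitVec b'.2) s
                * perF (fine Lc M) (dper (fine Lc M) (symVhSAt (ctr (3 + 1) Lc) 3 Lc rfl b.2 (b.1 : Site (3 + 1)))) (coarsePt M Lc a.1, Sum.inr a.2) (b'.1, Sum.inl b'.2)
            + tdelta (fine Lc M) ((b.1 : Site (3 + 1)) + unitVec b.2) s
                * perF (fine Lc M) (dper (fine Lc M) (symVhSAt (ctr (3 + 1) Lc) 3 Lc rfl b'.2 (b'.1 : Site (3 + 1)))) (coarsePt M Lc a.1, Sum.inr a.2) (b.1, Sum.inl b.2)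
            - tdelta (fine Lc M) ((b.1 : Site (3 + 1)) + unitVec b.2) s * ((if b = b' then (1 : ℝ) else 0) * ((((Lc : ℝ) ^ (3 + 1) * stepScale 3 Lc ℓ)⁻¹) * QstepSym Lc M ℓ a b))
            + tdelta (fine Lc M) ((rootPt M Lc hc (wrapPt M ((a.1 : Site (3 + 1)) + unitVec a.2)) : ↥(pbox (fine Lc M))) : Site (3 + 1)) s
                * (((((Lc : ℝ) ^ (3 + 1) * stepScale 3 Lc ℓ)⁻¹) * QstepSym Lc M ℓ a b) * ((((Lc : ℝ) ^ (3 + 1) * stepScale 3 Lc ℓ)⁻¹) * QstepSym Lc M ℓ a b'))) := by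
    rw [stepIns₂Sym, stepIns₂₂Sym, Matrix.sum_mul, Matrix.sum_apply]
    refine Finset.sum_congr rfl fun b _ => ?_
    rw [Matrix.sum_mul, Matrix.sum_apply]
    refine Finset.sum_congr rfl fun b' _ => ?_
    rw [Matrix.smul_mul, Matrix.smul_apply, smul_eq_mul, pair_mul_tgrad_apply_sym M Lc hc ℓ b b' a s]
  -- the right-hand side, entrywise
  have hR : ((2 : ℝ) • (stepIns₁Sym M Lc w * Matrix.of (fun (b : ↥(pbox (fine Lc M)) × Fin (3 + 1)) (s : ↥(pbox (fine Lc M))) =>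
              w b * tdelta (fine Lc M) ((b.1 : Site (3 + 1)) + unitVec b.2) s))
        - (((Lc : ℝ) ^ (3 + 1) * stepScale 3 Lc ℓ)⁻¹) • (QstepSym Lc M ℓ * Matrix.of (fun (b : ↥(pbox (fine Lc M)) × Fin (3 + 1)) (s : ↥(pbox (fine Lc M))) =>
              (w b * w b) * tdelta (fine Lc M) ((b.1 : Site (3 + 1)) + unitVec b.2) s))
        + (((Lc : ℝ) ^ (3 + 1) * stepScale 3 Lc ℓ)⁻¹) ^ 2 • Matrix.of (fun (a : ↥(pbox M) × Fin (3 + 1)) (s : ↥(pbox (fine Lc M))) =>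
              ((QstepSym Lc M ℓ *ᵥ w) a) ^ 2
                * tdelta (fine Lc M) ((rootPt M Lc hc (wrapPt M ((a.1 : Site (3 + 1)) + unitVec a.2)) : ↥(pbox (fine Lc M))) : Site (3 + 1)) s)) a s
      = 2 * (∑ b' : ↥(pbox (fine Lc M)) × Fin (3 + 1), (∑ b : ↥(pbox (fine Lc M)) × Fin (3 + 1),
              w b * perF (fine Lc M) (dper (fine Lc M) (symVhSAt (ctr (3 + 1) Lc) 3 Lc rfl b.2 (b.1 : Site (3 + 1)))) (coarsePt M Lc a.1, Sum.inr a.2) (b'.1, Sum.inl b'.2))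
            * (w b' * tdelta (fine Lc M) ((b'.1 : Site (3 + 1)) + unitVec b'.2) s))
        - (((Lc : ℝ) ^ (3 + 1) * stepScale 3 Lc ℓ)⁻¹) * (∑ b : ↥(pbox (fine Lc M)) × Fin (3 + 1), QstepSym Lc M ℓ a b * (w b * w b * tdelta (fine Lc M) ((b.1 : Site (3 + 1)) + unitVec b.2) s))
        + (((Lc : ℝ) ^ (3 + 1) * stepScale 3 Lc ℓ)⁻¹) ^ 2 * ((∑ b : ↥(pbox (fine Lc M)) × Fin (3 + 1), QstepSym Lc M ℓ a b * w b) ^ 2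
            * tdelta (fine Lc M) ((rootPt M Lc hc (wrapPt M ((a.1 : Site (3 + 1)) + unitVec a.2)) : ↥(pbox (fine Lc M))) : Site (3 + 1)) s) := by
    simp only [Matrix.add_apply, Matrix.sub_apply, Matrix.smul_apply, Matrix.mul_apply, Matrix.of_apply, smul_eq_mul, stepIns₁Sym_apply, Matrix.mulVec, dotProduct]
  rw [hL, hR]
  exact step_entry_algebra w (fun b => tdelta (fine Lc M) ((b.1 : Site (3 + 1)) + unitVec b.2) s) (fun b => QstepSym Lc M ℓ a b)
    (fun b b' => perF (fine Lc M) (dper (fine Lc M) (symVhSAt (ctr (3 + 1) Lc) 3 Lc rfl b.2 (b.1 : Site (3 + 1)))) (coarsePt M Lc a.1, Sum.inr a.2) (b'.1, Sum.inl b'.2))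
    (((Lc : ℝ) ^ (3 + 1) * stepScale 3 Lc ℓ)⁻¹)
    (tdelta (fine Lc M) ((rootPt M Lc hc (wrapPt M ((a.1 : Site (3 + 1)) + unitVec a.2)) : ↥(pbox (fine Lc M))) : Site (3 + 1)) s)

end OneStep

end Summit.QuantumFields.BalabanUV.Beta.FP.TorusCompositeCovarianceTwoStepSym

end
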